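import Literature.IUT.LogVolume.TameRadicalCoordinates
import Literature.IUT.LogVolume.IsometryGaloisOrder
import Mathlib.FieldTheory.KummerExtension
import HarnessLib

/-!
# The tame radical field `K = ℚ_p(π)`, `π^e = p`, `e ∣ p − 1`: Galois, a NORM-UNIMODULAR trace-dual pair, hence every isometry
# is a unit of `𝒪_K⟨Gal⟩`

abc-iut cell, seat abc-iut-E-t58 (gen 3; rung LADDER-ABC:A2.RESCUE.J, R-J row Y-29b/tame-e).  PROOF-ONLY classical local arithmetic; no
definition, no `Prop` fact, no `sorry`.  The radical rung of abc-iut-E-t42's `TameQuadraticDualPair.lean` (`e = 2`): it discharges the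
hypotheses of `IsometryGaloisOrder.lean` (Dedekind-coefficient criterion: `K/ℚ_p` GALOIS + a trace-dual pair of `ℚ_p`-bases `(b, d)` with
`‖b_m‖·‖d_m‖ ≤ 1`) at `K` any ultrametric normed field over `ℚ_p` with `[K : ℚ_p] = e`, `π ∈ K`, `π^e = p`, `e ∣ p − 1`, over part 1
`TameRadicalCoordinates.lean` (basis `(π^k)_{k<e}`, `‖e‖ = 1`, `μ_e ⊂ ℚ_p`).

* `trace_pi_pow_eq_zero` — `Tr_{K/ℚ_p}(π^k) = 0` for `0 < k < e` (the matrix of `π^k` in the basis `(π^j)` has zero diagonal: `π^k·π^j` is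
  `π^{k+j}` or `p·π^{k+j−e}`, never a multiple of `π^j`); `trace_smul_one` — `Tr(r·1) = e·r`;
* `adjoin_pi_eq_top`, **`isGalois`** — `K = ℚ_p(π)` is the splitting field of the separable `X^e − p` (Mathlib's Kummer theory:
  `isSplittingField_X_pow_sub_C_of_root_adjoin_eq_top`, `irreducible_X_pow_sub_C_of_root_adjoin_eq_top`,
  `isGalois_of_isSplittingField_X_pow_sub_C`, with the primitive `e`-th root of unity of part 1 / Gouvêa 4.6.1);
* **`exists_normUnimodular_dualPair`** — `b_j = π^j`, `d_i = π^{−i}/e` realised inside `K` as `d_0 = e⁻¹·1`, `d_i = (e·p)⁻¹·π^{e−i}`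
  (`0 < i < e`): `Tr(d_i b_j) = δ_{ij}` and `‖b_i‖·‖d_i‖ = 1` (`‖e‖ = 1`, `‖π‖^e = ‖p‖`);
* **`exists_galoisOrder_repr_of_isometry`** — hence EVERY `ℚ_p`-linear isometry `g` of `K` has `g`, `g⁻¹ ∈ 𝒪_K⟨Gal(K/ℚ_p)⟩` with integral
  coefficients: the `hIsmG` shape of the cell's `Summit.ABC.IUTFork.Joshi.PinsGaloisOrder` (p460152) holds for ALL isometries at such `K` —
  the ORDER-route companion (packets of every shape and slot count, mixed places) of this seat's PACKET-route
  `TameRadicalIsometryStable.congr_image_normalizedPacket_eq_of_isometry` (stability of `(R_I)^∼` of `K ⊗ K` by saturation).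

Nothing here is disputed mathematics; S-IDLE on print-shaped data; the consumer rows are the cell's typings [claim: Mochizuki2012,
status: disputed] of (Ind2). [cite: NeukirchANT1999, Ch. II (5.5)] [cite: SerreLocalFields1979, Ch. III §3]
[cite: Gouvea1993PadicNumbers, Prop. 4.6.1 (§4.6)]
-/

noncomputable section

open Module Polynomial IntermediateField

namespace Literature.IUT.LogVolume

namespace TameRadical

variable {p : ℕ} [Fact p.Prime] {K : Type} [NontriviallyNormedField K] [NormedAlgebra ℚ_[p] K] {π : K} {e : ℕ}

/-! ### Traces -/

/-- `π^{k+j}` in the coordinates `(π^m)_{m<e}` has `j`-th coordinate `0` when `0 < k < e` (it is `π^{k+j}` or `p·π^{k+j−e}`, a multiple of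
a basis vector other than `π^j`). [cite: NeukirchANT1999, Ch. II (5.5)] -/
theorem repr_pi_pow_add_self (hπ : π ^ e = (p : K)) (B : Basis (Fin e) ℚ_[p] K) (hB : ∀ m, B m = π ^ (m : ℕ))
    {k : ℕ} (hk0 : 0 < k) (hke : k < e) (j : Fin e) : B.repr (π ^ (k + (j : ℕ))) j = 0 := by
  by_cases hlt : k + (j : ℕ) < e
  · rw [repr_pi_pow B hB ⟨k + j, hlt⟩ j, if_neg]
    intro h
    have := congrArg Fin.val h
    simp only at this
    omega
  · have hsplit : π ^ (k + (j : ℕ)) = (p : ℚ_[p]) • π ^ (k + (j : ℕ) - e) := by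
      conv_lhs => rw [show k + (j : ℕ) = e + (k + (j : ℕ) - e) by omega, pow_add, hπ]
      rw [← map_natCast (algebraMap ℚ_[p] K) p, ← Algebra.smul_def]
    have hlt' : k + (j : ℕ) - e < e := by omega
    rw [hsplit, map_smul, Finsupp.smul_apply, repr_pi_pow B hB ⟨k + j - e, hlt'⟩ j, if_neg, smul_zero]
    intro h
    have := congrArg Fin.val h
    simp only at this
    omega

/-- **`Tr_{K/ℚ_p}(π^k) = 0` for `0 < k < e`** (`[K : ℚ_p] = e`, `π^e = p`): the matrix of `π^k` in the basis `(π^j)_{j<e}` has zero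
diagonal. [cite: NeukirchANT1999, Ch. II (5.5)] -/
theorem trace_pi_pow_eq_zero [IsUltrametricDist K] (he : 0 < e) (hK : finrank ℚ_[p] K = e) (hπ : π ^ e = (p : K)) {k : ℕ}
    (hk0 : 0 < k) (hke : k < e) : Algebra.trace ℚ_[p] K (π ^ k) = 0 := by
  classical
  obtain ⟨B, hB⟩ := exists_basis he hK hπ
  rw [Algebra.trace_eq_matrix_trace B, Matrix.trace]
  refine Finset.sum_eq_zero fun j _ => ?_
  rw [Matrix.diag_apply, Algebra.leftMulMatrix_eq_repr_mul, hB j, ← pow_add]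
  exact repr_pi_pow_add_self hπ B hB hk0 hke j

/-- **`Tr_{K/ℚ_p}(r·1) = e·r`** (`[K : ℚ_p] = e`). [cite: NeukirchANT1999, Ch. II (5.5)] -/
theorem trace_smul_one (hK : finrank ℚ_[p] K = e) (r : ℚ_[p]) : Algebra.trace ℚ_[p] K (r • (1 : K)) = e * r := by
  rw [← Algebra.algebraMap_eq_smul_one, Algebra.trace_algebraMap, hK, nsmul_eq_mul]

/-- `Tr(π^s) = 0` whenever `0 ≤ s < 2e` and `s ∉ {0, e}` (`π^s = p·π^{s−e}` past `e`). [cite: NeukirchANT1999, Ch. II (5.5)] -/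
theorem trace_pi_pow_eq_zero_of_ne [IsUltrametricDist K] (he : 0 < e) (hK : finrank ℚ_[p] K = e) (hπ : π ^ e = (p : K)) {s : ℕ}
    (hs0 : s ≠ 0) (hse : s ≠ e) (hs2 : s < 2 * e) : Algebra.trace ℚ_[p] K (π ^ s) = 0 := by
  by_cases hlt : s < e
  · exact trace_pi_pow_eq_zero he hK hπ (Nat.pos_of_ne_zero hs0) hlt
  · have hsplit : π ^ s = (p : ℚ_[p]) • π ^ (s - e) := by
      conv_lhs => rw [show s = e + (s - e) by omega, pow_add, hπ]
      rw [← map_natCast (algebraMap ℚ_[p] K) p, ← Algebra.smul_def]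
    rw [hsplit, map_smul, trace_pi_pow_eq_zero he hK hπ (by omega) (by omega), smul_zero]

/-! ### `K = ℚ_p(π)` is Galois over `ℚ_p` (`e ∣ p − 1`) -/

/-- `ℚ_p(π) = K`: the powers of `π` span `K` (`[K : ℚ_p] = e`). [cite: NeukirchANT1999, Ch. II (5.5)] -/
theorem adjoin_pi_eq_top [IsUltrametricDist K] (he : 0 < e) (hK : finrank ℚ_[p] K = e) (hπ : π ^ e = (p : K)) :
    ℚ_[p]⟮π⟯ = ⊤ := by
  obtain ⟨B, hB⟩ := exists_basis he hK hπ
  rw [eq_top_iff]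
  intro x _
  rw [← sum_repr B hB x]
  exact sum_mem fun k _ => (ℚ_[p]⟮π⟯).smul_mem (pow_mem (mem_adjoin_simple_self ℚ_[p] π) _)

/-- **`K = ℚ_p(p^{1/e})` is GALOIS over `ℚ_p` for `e ∣ p − 1`**: `μ_e ⊂ ℚ_p` (part 1 / Gouvêa 4.6.1), so `K = ℚ_p(π)` is the splitting
field of `X^e − p`, irreducible and separable (Mathlib's Kummer theory). [cite: NeukirchANT1999, Ch. II (5.5)] [cite: Gouvea1993PadicNumbers, Prop. 4.6.1 (§4.6)] -/
theorem isGalois [IsUltrametricDist K] (hep : e ∣ p - 1) (hK : finrank ℚ_[p] K = e) (hπ : π ^ e = (p : K)) : IsGalois ℚ_[p] K := by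
  have he := pos_of_dvd_sub_one hep
  haveI : FiniteDimensional ℚ_[p] K := Module.finite_of_finrank_pos (by rw [hK]; exact he)
  obtain ⟨ζ, hζ⟩ := exists_isPrimitiveRoot (p := p) hep
  have hprim : (primitiveRoots (finrank ℚ_[p] K) ℚ_[p]).Nonempty :=
    ⟨ζ, by rw [hK, mem_primitiveRoots he]; exact hζ⟩
  have ha : π ^ finrank ℚ_[p] K = algebraMap ℚ_[p] K (p : ℚ_[p]) := by rw [hK, hπ, map_natCast]
  have hα : ℚ_[p]⟮π⟯ = ⊤ := adjoin_pi_eq_top he hK hπ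
  haveI := isSplittingField_X_pow_sub_C_of_root_adjoin_eq_top hprim ha hα
  exact isGalois_of_isSplittingField_X_pow_sub_C hprim (irreducible_X_pow_sub_C_of_root_adjoin_eq_top ha hα) K

/-! ### The norm-unimodular trace-dual pair -/

/-- **THE NORM-UNIMODULAR TRACE-DUAL PAIR OF A TAME RADICAL FIELD**: for `e ∣ p − 1`, `[K : ℚ_p] = e`, `π^e = p`, the bases
`b_j = π^j` and `d_0 = e⁻¹·1`, `d_i = (e·p)⁻¹·π^{e−i}` (`0 < i < e`; i.e. `d_i = π^{−i}/e`) satisfy `Tr(d_i b_j) = δ_{ij}` (`Tr(π^s) = 0`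
for `0 < s < 2e`, `s ≠ e`; `Tr(1) = e`, `Tr(p) = e·p`) and `‖b_i‖·‖d_i‖ = 1` (`‖e‖ = 1`, `‖π‖^e = ‖p‖`) — the hypothesis of
`IsometryGaloisOrder.exists_galoisOrder_repr_of_isometry`. [cite: NeukirchANT1999, Ch. II (5.5)] [cite: SerreLocalFields1979, Ch. III §3] -/
theorem exists_normUnimodular_dualPair [IsUltrametricDist K] (hep : e ∣ p - 1) (hK : finrank ℚ_[p] K = e) (hπ : π ^ e = (p : K)) :
    ∃ b d : Basis (Fin e) ℚ_[p] K,
      (∀ i j, Algebra.trace ℚ_[p] K (d i * b j) = if j = i then 1 else 0) ∧ ∀ i, ‖b i‖ * ‖d i‖ ≤ 1 := by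
  have he := pos_of_dvd_sub_one hep
  have hpe := not_dvd_of_dvd_sub_one hep
  obtain ⟨B, hB⟩ := exists_basis he hK hπ
  have hp0 : (p : ℚ_[p]) ≠ 0 := by exact_mod_cast (Fact.out : p.Prime).ne_zero
  have he0 : (e : ℚ_[p]) ≠ 0 := by exact_mod_cast he.ne'
  have henorm : ‖(e : ℚ_[p])‖ = 1 := norm_natCast_eq_one hpe
  -- the involution `i ↦ −i (mod e)` of `Fin e`, built by hand
  let f : Fin e → Fin e := fun i => ⟨(e - (i : ℕ)) % e, Nat.mod_lt _ he⟩
  have hf0 : ∀ i : Fin e, (i : ℕ) = 0 → ((f i : Fin e) : ℕ) = 0 := fun i hi => by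
    show (e - (i : ℕ)) % e = 0
    rw [hi, Nat.sub_zero, Nat.mod_self]
  have hfpos : ∀ i : Fin e, (i : ℕ) ≠ 0 → ((f i : Fin e) : ℕ) = e - (i : ℕ) := fun i hi => by
    show (e - (i : ℕ)) % e = e - (i : ℕ)
    exact Nat.mod_eq_of_lt (by have := i.2; omega)
  have hff : Function.Involutive f := fun i => by
    apply Fin.ext
    by_cases hi : (i : ℕ) = 0
    · rw [hf0 (f i) (hf0 i hi), hi]
    · rw [hfpos (f i) (by rw [hfpos i hi]; have := i.2; omega), hfpos i hi]
      have := i.2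
      omega
  let σ : Fin e ≃ Fin e := ⟨f, f, hff, hff⟩
  have hσ : ∀ i, σ.symm i = f i := fun _ => rfl
  -- the scalars `w_0 = e⁻¹`, `w_i = (e·p)⁻¹`
  let w : Fin e → ℚ_[p]ˣ := fun i =>
    if (i : ℕ) = 0 then Units.mk0 ((e : ℚ_[p])⁻¹) (inv_ne_zero he0)
    else Units.mk0 ((e : ℚ_[p]) * p)⁻¹ (inv_ne_zero (mul_ne_zero he0 hp0))
  have hw0 : ∀ i : Fin e, (i : ℕ) = 0 → ((w i : ℚ_[p]ˣ) : ℚ_[p]) = (e : ℚ_[p])⁻¹ := fun i hi => by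
    show ((if (i : ℕ) = 0 then _ else _ : ℚ_[p]ˣ) : ℚ_[p]) = _
    rw [if_pos hi]; rfl
  have hwpos : ∀ i : Fin e, (i : ℕ) ≠ 0 → ((w i : ℚ_[p]ˣ) : ℚ_[p]) = ((e : ℚ_[p]) * p)⁻¹ := fun i hi => by
    show ((if (i : ℕ) = 0 then _ else _ : ℚ_[p]ˣ) : ℚ_[p]) = _
    rw [if_neg hi]; rfl
  -- `d_i = w_i · π^{f i}`
  have hd : ∀ i, (B.reindex σ).unitsSMul w i = ((w i : ℚ_[p]ˣ) : ℚ_[p]) • π ^ ((f i : Fin e) : ℕ) := fun i => by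
    rw [Basis.unitsSMul_apply, Units.smul_def, Basis.reindex_apply, hσ, hB]
  have htr : ∀ i j, Algebra.trace ℚ_[p] K ((B.reindex σ).unitsSMul w i * B j) =
      ((w i : ℚ_[p]ˣ) : ℚ_[p]) * Algebra.trace ℚ_[p] K (π ^ (((f i : Fin e) : ℕ) + (j : ℕ))) := fun i j => by
    rw [hd, hB, smul_mul_assoc, ← pow_add, map_smul, smul_eq_mul]
  have hp1 : (p : K) = (p : ℚ_[p]) • (1 : K) := by
    rw [← map_natCast (algebraMap ℚ_[p] K) p, Algebra.algebraMap_eq_smul_one]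
  refine ⟨B, (B.reindex σ).unitsSMul w, fun i j => ?_, fun i => ?_⟩
  · -- traces
    rw [htr]
    by_cases hi : (i : ℕ) = 0
    · rw [hf0 i hi, zero_add, hw0 i hi]
      by_cases hj : (j : ℕ) = 0
      · have hji : j = i := Fin.ext (by rw [hj, hi])
        rw [if_pos hji, hj, pow_zero, show (1 : K) = (1 : ℚ_[p]) • (1 : K) by rw [one_smul], trace_smul_one hK, mul_one,
          inv_mul_cancel₀ he0]
      · have hji : j ≠ i := fun h => hj (by rw [h, hi])
        rw [if_neg hji, trace_pi_pow_eq_zero he hK hπ (Nat.pos_of_ne_zero hj) j.2, mul_zero]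
    · rw [hfpos i hi, hwpos i hi]
      by_cases hji : j = i
      · subst hji
        rw [if_pos rfl, Nat.sub_add_cancel j.2.le, hπ, hp1, trace_smul_one hK, inv_mul_cancel₀ (mul_ne_zero he0 hp0)]
      · have hj := j.2
        have hi' := i.2
        have hne : (j : ℕ) ≠ (i : ℕ) := fun h => hji (Fin.ext h)
        rw [if_neg hji, trace_pi_pow_eq_zero_of_ne he hK hπ (by omega) (by omega) (by omega), mul_zero]
  · -- norms
    rw [hd, hB, norm_smul, norm_pow]
    by_cases hi : (i : ℕ) = 0
    · rw [hf0 i hi, hw0 i hi, hi, pow_zero, pow_zero, norm_one, norm_inv, henorm]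
      norm_num
    · rw [hfpos i hi, hwpos i hi, norm_pow, norm_inv, norm_mul, henorm, one_mul, Padic.norm_p, inv_inv, mul_left_comm,
        ← pow_add, Nat.add_sub_cancel' i.2.le, norm_pi_pow_e hπ,
        mul_inv_cancel₀ (by exact_mod_cast (Fact.out : p.Prime).ne_zero : (p : ℝ) ≠ 0)]

/-- **Every `ℚ_p`-linear ISOMETRY of a tame radical `K` (`e ∣ p − 1`, `[K : ℚ_p] = e`, `π^e = p`) is a UNIT OF THE INTEGRAL GALOIS ORDER
`𝒪_K⟨Gal(K/ℚ_p)⟩`**: `g` and `g⁻¹` are `Σ_σ c_σ·σ` with `‖c_σ‖ ≤ 1` — the `hIsmG` shape of the cell's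
`Summit.ABC.IUTFork.Joshi.PinsGaloisOrder.exists_pinnedRegions_honestSetting_of_galoisOrderIsm` (p460152), here for ALL isometries at such
`K` (contrast: `TameRadicalIsometryStable.congr_image_normalizedPacket_eq_of_isometry` proves the stability of `(R_I)^∼` of `K ⊗ K`
directly; this form feeds packets of every shape). [cite: SerreLocalFields1979, Ch. III §3] [cite: NeukirchANT1999, Ch. II (5.5)] -/
theorem exists_galoisOrder_repr_of_isometry [IsUltrametricDist K] [ProperSpace K] (hep : e ∣ p - 1) (hK : finrank ℚ_[p] K = e)
    (hπ : π ^ e = (p : K)) (g : K ≃ₗ[ℚ_[p]] K) (hg : ∀ x, ‖g x‖ = ‖x‖) :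
    (∃ (T : Finset (K ≃ₐ[ℚ_[p]] K)) (c : (K ≃ₐ[ℚ_[p]] K) → K), (∀ τ ∈ T, ‖c τ‖ ≤ 1) ∧ ∀ x, g x = ∑ τ ∈ T, c τ * τ x) ∧
    (∃ (T : Finset (K ≃ₐ[ℚ_[p]] K)) (c : (K ≃ₐ[ℚ_[p]] K) → K), (∀ τ ∈ T, ‖c τ‖ ≤ 1) ∧ ∀ x, g.symm x = ∑ τ ∈ T, c τ * τ x) := by
  classical
  have he := pos_of_dvd_sub_one hep
  haveI : FiniteDimensional ℚ_[p] K := Module.finite_of_finrank_pos (by rw [hK]; exact he)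
  haveI := isGalois hep hK hπ
  obtain ⟨b, d, hbd, hnorm⟩ := exists_normUnimodular_dualPair hep hK hπ
  exact Literature.IUT.LogVolume.exists_galoisOrder_repr_of_isometry b d hbd hnorm g hg

end TameRadical

/-- **NON-VACUITY of the radical rung of the Galois-order route**: for every prime `p` and every `e ∣ p − 1` there is a finite `E ⊆ ℚ̄_p`
with `[E : ℚ_p] = e` (`E = ℚ_p(p^{1/e})`) at which EVERY `ℚ_p`-linear isometry `g` has `g`, `g⁻¹ ∈ 𝒪_E⟨Gal(E/ℚ_p)⟩` with integral
coefficients. [cite: SerreLocalFields1979, Ch. III §3] [cite: NeukirchANT1999, Ch. II (5.5)] -/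
theorem exists_tameRadical_galoisOrder (p : ℕ) [Fact p.Prime] {e : ℕ} (hep : e ∣ p - 1) :
    ∃ (E : IntermediateField ℚ_[p] (PadicAlgCl p)) (_ : FiniteDimensional ℚ_[p] E), finrank ℚ_[p] E = e ∧
      ∀ g : (E : Type) ≃ₗ[ℚ_[p]] E, (∀ x, ‖g x‖ = ‖x‖) →
        (∃ (T : Finset ((E : Type) ≃ₐ[ℚ_[p]] E)) (c : ((E : Type) ≃ₐ[ℚ_[p]] E) → E),
            (∀ τ ∈ T, ‖c τ‖ ≤ 1) ∧ ∀ x, g x = ∑ τ ∈ T, c τ * τ x) ∧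
        (∃ (T : Finset ((E : Type) ≃ₐ[ℚ_[p]] E)) (c : ((E : Type) ≃ₐ[ℚ_[p]] E) → E),
            (∀ τ ∈ T, ‖c τ‖ ≤ 1) ∧ ∀ x, g.symm x = ∑ τ ∈ T, c τ * τ x) := by
  obtain ⟨E, π, hfd, hK, hπ⟩ := TameRadical.exists_subfield p (TameRadical.pos_of_dvd_sub_one (p := p) hep)
  exact ⟨E, hfd, hK, fun g hg => TameRadical.exists_galoisOrder_repr_of_isometry (K := E) hep hK hπ g hg⟩

end Literature.IUT.LogVolume

end
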